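import Literature.Computability.Cryptography.OracleAdversaryFPRel
import Literature.Computability.Complexity.OracleCompositionMachine
import Literature.Computability.Complexity.OracleClosure
import Literature.Computability.Complexity.OracleProofs
import Literature.Computability.Complexity.PRelHierarchy
import Literature.Computability.Complexity.OracleBPPAmplification
import HarnessLib

/-!
# A PPT oracle adversary with STRING outputs whose first output bit decides a language puts it in `BPP^A`

Bridge between the C4a *oracle adversary* of `Cryptography/OracleGames.lean` (a polynomial-time
step function with polynomial coin and round budgets; output law `OracleAdversary.outputPMF`,
the machines of the sampling class `SampBPP^O`) and G01's operator class
`BPP^O = bp (P^O)` (`Complexity/Oracle.lean`, `ProbabilisticClasses.lean`: a witness language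
`L' ∈ P^O` read on the pair `⟨x, coins⟩`, counting probability `uniformProb`), against a
LANGUAGE oracle `Oracle.ofLanguage A`. Theorems only:

* `OracleAdversary.headTrueLang_mem_PRel` — for a PPT adversary `𝒜` with string outputs, the
  language `L' = {w | the output of 𝒜 on w = ⟨x, r⟩ (coins r, round budget fuel |x|, no output
  read as ε) starts with 1}` is in `P^A`. No machine is built: the clocked run is an `FP^A`
  function (`OracleAdversary.clockedRun_mem_FPRel`, `OracleAdversaryFPRel.lean`), post-composed
  with the finite-state test `headT` it is the ORACLE of `L'` (`Oracle.ofLanguage L'`), so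
  `L' ∈ P^{L'} ⊆ P^A` (`self_mem_PRel_ofLanguage_holds`, `OracleAlg.PRel_subset_PRel_of_mem_FPRel`);
* `OracleAdversary.uniformProb_run_mem` — the counting probability, over coin strings
  `y ∈ {0,1}^{coins |x|}`, that the run on `⟨x, y⟩` lands in an event `S` is the mass of `S`
  under the output law `(𝒜.outputPMF O x).map (·.getD [])` (both are push-forwards of the
  uniform distribution on `{0,1}^{coins |x|}`, `uniformProb_eq_toOuterMeasure`);
* `OracleAdversary.exists_PRel_uniformProb_eq` — hence a witness `L' ∈ P^A` and the coin
  polynomial `𝒜.coins` with `Pr_y[⟨x, y⟩ ∈ L'] = Pr[𝒜^A(x) starts with 1]` for every `x`;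
* `OracleAdversary.mem_bpErr_PRel` — **if `Pr[𝒜^A(x) starts with 1]` is `≥ 1 - e` on `x ∈ L`
  and `≤ e` off `L`, then `L ∈ bpErr (P^A) e`** (Arora–Barak's Def. 7.3 form of a bounded-error
  machine, relativized: Def. 7.1 with §3.4); with the tree's amplification
  `bpErr_PRel_subset_BPPRel` (`OracleBPPAmplification.lean`, any `e < 1/2`):
  `OracleAdversary.mem_BPPRel_of_headProb` and the comparison form
  `OracleAdversary.mem_BPPRel_of_headProb_abs_sub_le` (`|Pr[𝒜^A(x) starts with 1] − π x| ≤ η`,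
  `π ≥ 2/3` on `L`, `≤ 1/3` off `L`, `η < 1/6`).

This is the string-output twin of `OracleAdversaryDecider.lean` (Boolean adversaries,
acceptance = output `some true`; witness machine `decider` built there by capping and clocking):
the machines of the sampling class `SampBPP^O` (`Literature.Barriers.QuantumAdvantage.SampPRel`)
output STRINGS, a missing output read as `ε`, and are consumed through their first output bit;
here no machine is built at all (the clocked run is already an `FP^A` function,
`OracleAdversaryFPRel.lean`). Consumer: the sampling-to-language bridge "`SampBQP^A ⊆ SampBPP^A`
implies `BQP^A ⊆ BPP^A`" (Aaronson–Chen 2017, Thm. 8.1, "and consequently";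
`Literature/Barriers/QuantumAdvantage/PPolyOraclesSampToLanguage.lean`), where `𝒜` is a
`SampBPP^A` sampler for the answer bit of a `BQP^A` family.

## References

* S. Arora, B. Barak, *Computational Complexity: A Modern Approach*, CUP 2009, Def. 7.1 and the
  remark after it (probabilistic machines as deterministic machines reading a random string),
  Def. 7.3 (`BPP` via random strings), §7.4.1 (two-sided error `e`), §3.4 (oracle machines)
  [AroraBarakCC2009].
* C. H. Bennett, J. Gill, SIAM J. Comput. 10 (1981), §1 (`BPP^A`) [BennettGill1981].
* O. Goldreich, *Foundations of Cryptography I*, CUP 2001, §3.6, Def. 3.6.4 (probabilistic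
  polynomial-time oracle machines), as used in `OracleGames.lean` [Goldreich2001].
-/

noncomputable section

namespace Literature.Computability.Cryptography

open _root_.Computability Complexity Complexity.PRelSigma

namespace OracleAdversary

/-! ### The witness language of an adversary is in `P^A` -/

/-- The one-bit post-processing "does the output start with `1`?" turns the clocked run of `𝒜`
(an `FP^A` function, `clockedRun_mem_FPRel`) into the oracle of the language
`{w | the run on w starts with 1}`. [folklore] -/
theorem headT_comp_clockedRun_eq_ofLanguage (𝒜 : OracleAdversary (List Bool)) (O : Oracle) :
    (headT true).eval ∘
        (fun w => (𝒜.alg.run O (𝒜.fuel.eval (boolUnpair w).1.length) w).getD []) =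
      Oracle.ofLanguage
        {w | ((𝒜.alg.run O (𝒜.fuel.eval (boolUnpair w).1.length) w).getD []).head? = some true} := by
  funext w
  simp only [Function.comp_apply, headT_eval, Oracle.ofLanguage_apply]
  by_cases hw : ((𝒜.alg.run O (𝒜.fuel.eval (boolUnpair w).1.length) w).getD []).head? = some true
  · rw [decide_eq_true hw, (Set.mem_iff_boolIndicator
      {w | ((𝒜.alg.run O (𝒜.fuel.eval (boolUnpair w).1.length) w).getD []).head? = some true} w).1 hw]
    rfl
  · rw [decide_eq_false hw, (Set.notMem_iff_boolIndicator
      {w | ((𝒜.alg.run O (𝒜.fuel.eval (boolUnpair w).1.length) w).getD []).head? = some true} w).1 hw]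
    rfl

/-- **The witness language of a PPT adversary is in `P^A`.** For a PPT oracle adversary `𝒜` with
string outputs and a language oracle `A`, the language of machine inputs `w = ⟨x, r⟩` on which the
run of `𝒜` (round budget `fuel |x|`, a missing output read as `ε`) outputs a string starting with
`1` is in `PRel (Oracle.ofLanguage A)`: its oracle is `headT ∘ (clocked run) ∈ FP^A`
(`clockedRun_mem_FPRel`, `FP_comp_mem_FPRel`), it is in `P` relative to its own oracle
(`self_mem_PRel_ofLanguage_holds`), and `f ∈ FP^A ⟹ P^f ⊆ P^A`
(`OracleAlg.PRel_subset_PRel_of_mem_FPRel`). [cite: AroraBarakCC2009, Def. 7.1 with §3.4] -/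
theorem headTrueLang_mem_PRel (𝒜 : OracleAdversary (List Bool)) (h𝒜 : 𝒜.IsPPT (encodingList Bool))
    (A : Language Bool) :
    ({w | ((𝒜.alg.run (Oracle.ofLanguage A) (𝒜.fuel.eval (boolUnpair w).1.length) w).getD []).head? =
        some true} : Language Bool) ∈ PRel (Oracle.ofLanguage A) := by
  have hg := clockedRun_mem_FPRel 𝒜 h𝒜 A
  have hh := FP_comp_mem_FPRel hg (headT true).polyTimeComputable_eval
  rw [headT_comp_clockedRun_eq_ofLanguage] at hh
  exact OracleAlg.PRel_subset_PRel_of_mem_FPRel hh (self_mem_PRel_ofLanguage_holds _)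

/-! ### Counting probability over the coins = output law -/

/-- **Coins counted = output law.** For every oracle `O`, input `x` and event `S`, the fraction of
coin strings `y ∈ {0,1}^{coins |x|}` whose run on `⟨x, y⟩` (budget `fuel |x|`, `none ↦ ε`) lands
in `S` equals the mass of `S` under `(𝒜.outputPMF O x).map (·.getD [])` — both are the
push-forward of the uniform distribution on `{0,1}^{coins |x|}` (`uniformProb_eq_toOuterMeasure`,
`OracleAdversary.outputPMF_eq_map`). [cite: AroraBarakCC2009, Def. 7.1 (remark: random strings)] -/
theorem uniformProb_run_mem (𝒜 : OracleAdversary (List Bool)) (O : Oracle) (x : List Bool)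
    (S : Set (List Bool)) :
    uniformProb (𝒜.coins.eval x.length)
        {y | (𝒜.alg.run O (𝒜.fuel.eval x.length) (boolPair x y)).getD [] ∈ S} =
      ((PMF.map (fun o => o.getD []) (𝒜.outputPMF O x)).toOuterMeasure S).toReal := by
  rw [uniformProb_eq_toOuterMeasure, outputPMF_eq_map, PMF.map_comp, PMF.toOuterMeasure_map_apply]
  rfl

/-- **A `P^A` witness with the right statistics.** For a PPT adversary `𝒜` and a language oracle
`A` there is `L' ∈ P^A` such that, for every input `x`, the fraction of coin strings
`y ∈ {0,1}^{coins |x|}` with `⟨x, y⟩ ∈ L'` is exactly the probability that `𝒜^A(x)` outputs a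
string starting with `1` (`headTrueLang_mem_PRel`, `uniformProb_run_mem`).
[cite: AroraBarakCC2009, Def. 7.1 and Def. 7.3 with §3.4] -/
theorem exists_PRel_uniformProb_eq (𝒜 : OracleAdversary (List Bool)) (h𝒜 : 𝒜.IsPPT (encodingList Bool))
    (A : Language Bool) :
    ∃ L' ∈ PRel (Oracle.ofLanguage A), ∀ x : List Bool,
      uniformProb (𝒜.coins.eval x.length) {y | boolPair x y ∈ L'} =
        ((PMF.map (fun o => o.getD []) (𝒜.outputPMF (Oracle.ofLanguage A) x)).toOuterMeasure
          {s | s.head? = some true}).toReal := by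
  refine ⟨_, headTrueLang_mem_PRel 𝒜 h𝒜 A, fun x => ?_⟩
  rw [← uniformProb_run_mem 𝒜 (Oracle.ofLanguage A) x {s | s.head? = some true}]
  congr 1
  ext y
  change ((𝒜.alg.run (Oracle.ofLanguage A) (𝒜.fuel.eval (boolUnpair (boolPair x y)).1.length)
    (boolPair x y)).getD []).head? = some true ↔ _
  rw [boolUnpair_boolPair]
  rfl

/-- **A PPT oracle adversary deciding `L` with two-sided error `e` puts `L` in `bpErr (P^A) e`.**
If `Pr[𝒜^A(x) starts with 1] ≥ 1 - e` for `x ∈ L` and `≤ e` for `x ∉ L` (probability over the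
coins of `𝒜`, output law `(𝒜.outputPMF (Oracle.ofLanguage A) x).map (·.getD [])`), then `L` has
a `P^A` witness with coin polynomial `𝒜.coins` whose wrong-verdict probability is at most `e` on
every input — Arora–Barak's random-string form of a bounded-error machine (Def. 7.3 with §7.4.1),
relativized (§3.4). [cite: AroraBarakCC2009, Def. 7.3 and §7.4.1 with §3.4] [cite: BennettGill1981, §1] -/
theorem mem_bpErr_PRel (𝒜 : OracleAdversary (List Bool)) (h𝒜 : 𝒜.IsPPT (encodingList Bool))
    (A : Language Bool) {L : Language Bool} {e : ℝ}
    (hyes : ∀ x ∈ L, 1 - e ≤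
      ((PMF.map (fun o => o.getD []) (𝒜.outputPMF (Oracle.ofLanguage A) x)).toOuterMeasure
        {s | s.head? = some true}).toReal)
    (hno : ∀ x ∉ L,
      ((PMF.map (fun o => o.getD []) (𝒜.outputPMF (Oracle.ofLanguage A) x)).toOuterMeasure
        {s | s.head? = some true}).toReal ≤ e) :
    L ∈ bpErr (PRel (Oracle.ofLanguage A)) e := by
  obtain ⟨L', hL', hstat⟩ := exists_PRel_uniformProb_eq 𝒜 h𝒜 A
  refine ⟨L', hL', 𝒜.coins, fun x => ?_⟩
  by_cases hx : x ∈ L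
  · have hset : {y : List Bool | ¬ (boolPair x y ∈ L' ↔ x ∈ L)} = {y : List Bool | boolPair x y ∈ L'}ᶜ := by
      ext y
      simp [hx]
    rw [hset, uniformProb_compl, hstat x]
    have h := hyes x hx
    linarith
  · have hset : {y : List Bool | ¬ (boolPair x y ∈ L' ↔ x ∈ L)} = {y : List Bool | boolPair x y ∈ L'} := by
      ext y
      simp [hx]
    rw [hset, hstat x]
    exact hno x hx

/-- **A PPT string-output oracle adversary whose first bit decides `L` with error `e < 1/2` puts
`L` in `BPP^A`** (`mem_bpErr_PRel` and the amplification `bpErr_PRel_subset_BPPRel` of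
`OracleBPPAmplification.lean`). [cite: AroraBarakCC2009, Def. 7.3 and §7.4.1 with §3.4] [cite: BennettGill1981, §1] -/
theorem mem_BPPRel_of_headProb (𝒜 : OracleAdversary (List Bool)) (h𝒜 : 𝒜.IsPPT (encodingList Bool))
    (A : Language Bool) {L : Language Bool} {e : ℝ} (he : e < 1 / 2)
    (hyes : ∀ x ∈ L, 1 - e ≤
      ((PMF.map (fun o => o.getD []) (𝒜.outputPMF (Oracle.ofLanguage A) x)).toOuterMeasure
        {s | s.head? = some true}).toReal)
    (hno : ∀ x ∉ L,
      ((PMF.map (fun o => o.getD []) (𝒜.outputPMF (Oracle.ofLanguage A) x)).toOuterMeasure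
        {s | s.head? = some true}).toReal ≤ e) :
    L ∈ BPPRel (Oracle.ofLanguage A) :=
  bpErr_PRel_subset_BPPRel A he (mem_bpErr_PRel 𝒜 h𝒜 A hyes hno)

/-- The comparison form: if the probability that `𝒜^A(x)` starts with `1` is within `η` of a
reference `π x` with `π x ≥ 2/3` on `L` and `π x ≤ 1/3` off `L`, and `η < 1/6`, then
`L ∈ BPP^A` (error `1/3 + η < 1/2`). This is the form in which a `SampBPP^A` sampler within
total variation `η` of the answer bit of a `BQP^A` family is consumed.
[cite: AroraBarakCC2009, §7.4.1 with §3.4] -/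
theorem mem_BPPRel_of_headProb_abs_sub_le (𝒜 : OracleAdversary (List Bool))
    (h𝒜 : 𝒜.IsPPT (encodingList Bool)) {A L : Language Bool} {π : List Bool → ℝ} {η : ℝ}
    (hη : η < 1 / 6)
    (happrox : ∀ x,
      |((PMF.map (fun o => o.getD []) (𝒜.outputPMF (Oracle.ofLanguage A) x)).toOuterMeasure
          {s | s.head? = some true}).toReal - π x| ≤ η)
    (hyes : ∀ x ∈ L, 2 / 3 ≤ π x) (hno : ∀ x ∉ L, π x ≤ 1 / 3) :
    L ∈ BPPRel (Oracle.ofLanguage A) := by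
  refine mem_BPPRel_of_headProb 𝒜 h𝒜 A (e := 1 / 3 + η) (by linarith) (fun x hx => ?_) (fun x hx => ?_)
  · have h := happrox x
    rw [abs_le] at h
    linarith [hyes x hx]
  · have h := happrox x
    rw [abs_le] at h
    linarith [hno x hx]

end OracleAdversary

end Literature.Computability.Cryptography

end
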